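import Summits.CriticalPhenomena.CardyFormulaZ2.Theorems.CardyComplexConeParafermionToSLESixFamiliesIicDefs
import Literature.Probability.Percolation.InterfaceScalingLimitDiscretised
import Literature.Probability.Percolation.InterfaceTraversalBoundData4
import HarnessLib

/-!
# Tightness half of stub S6 `stub_sleLawOnRectilinear` of line `iic-trace-flux-pairing` (crux `ParafermionToSLESixFamilies`, stmt-CriticalPhenomena-11389)

Route `CardyComplexCone` (sub-problem `CriticalPhenomena/CardyFormulaZ2`), crux
`Summit.CriticalPhenomena.CardyFormulaZ2.Theses.CardyComplexCone.ParafermionToSLESixFamilies`, line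
`iic-trace-flux-pairing` (skeleton `Cruxes/ParafermionToSLESixFamilies/Lines/iic_trace_flux_pairing.lean`,
vocabulary `Theorems/CardyComplexConeParafermionToSLESixFamiliesIicDefs.lean`). Stub S6 reads
`(∀ D, IsRectilinear D → TouchLawPos D) → TightOnRectilinear ∧ IdentOnRectilinear`; this file closes its
TIGHTNESS half unconditionally, as the registered glue sub-goals

* `tight_of_isFamily : ∀ D Λ, IsFamily D Λ → IsTightAlongMesh (iface D Λ) perc` — tightness of the laws of
  the crux's interface functional along every admissible family of EVERY Dobrushin domain (rectilinearity
  is not needed), and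
* `tightOnRectilinear : TightOnRectilinear` — its restriction to rectilinear polygons, the first conjunct
  of S6.

Source of the mathematics: Aizenman–Burchard, Duke Math. J. 99 (1999), Thm 1.2 (uniform power bounds on
multiple annulus traversals from RSW + BK ⇒ tightness of the interface laws), carried out for ARBITRARY
admissible discrete Dobrushin data by the Literature files `InterfaceTraversalBoundData{,2,3,4}.lean`
(landed by the dead line `caratheodory-net-slit-uniformity` of this crux, stub `stub_tightFamilies`),
ending in `Literature.Probability.Percolation.isTightAlongMesh_bondInterfaceIn`. The only observation
needed here is that the crux's interface functional `iface D Λ δ` (the verbatim `if … then γ else γ ∘ symm`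
of block C) IS the Literature's `bondInterfaceIn D (Λ δ)` definitionally (`iface_eq_bondInterfaceIn`):
`orientCurve D γ` is the same endpoint rule and `reverseCurve γ = γ.comp ⟨unitInterval.symm, _⟩`.
(buildfix 2026-08-20: comment-only re-land to re-enqueue the module build after its blocking imports
(CardyComplexConeDefs, ShiftCouplingLocalityReduction) were rebuilt; no declaration changed.)
-/

noncomputable section

namespace Summit.CriticalPhenomena.CardyFormulaZ2.Cruxes.ParafermionToSLESixFamilies.IicTraceFluxPairing

open scoped Topology
open Filter MeasureTheory
open Literature.Probability.LatticeModels Literature.Probability.Percolation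
open Literature.Probability.RandomPlanarGeometry
-- buildfix lane 2026-08-20: namespace-local alias(es) so that short names made ambiguous by the
-- 2026-08-15 Literature migration (old home vs re-exported new home, both in the import cone) resolve,
-- as in the accepted build, to the OLD home `Literature.Probability.Percolation`. No declaration text changes.
export Literature.Probability.Percolation (bondInterfaceIn bondInterfaceIn_apply)

/-- The interface functional of the crux is the Literature's `bondInterfaceIn`, definitionally: the endpoint
rule `orientCurve D` is the same `if dist (γ 0) a ≤ dist (γ 0) b then γ else reverseCurve γ`, and
`reverseCurve γ = γ.comp ⟨unitInterval.symm, unitInterval.continuous_symm⟩`. -/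
theorem iface_eq_bondInterfaceIn (D : DobrushinDomain) (Λ : ℝ → DiscreteDobrushin) :
    iface D Λ = fun δ => bondInterfaceIn D (Λ δ) := rfl

/-- **Tightness along every admissible family of every Dobrushin domain** (registered glue sub-goal; the
all-domains form of the tightness half of S6): for every Dobrushin domain `D` and every `Λ` with
`IsFamily D Λ`, the laws of `iface D Λ δ` under critical bond percolation are tight along the mesh filter
`δ → 0⁺`. Aizenman–Burchard 1999, Thm 1.2, for arbitrary admissible data
(`isTightAlongMesh_bondInterfaceIn`, `InterfaceTraversalBoundData4.lean`); only the fields `Ω = D`,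
mesh `= δ` and eventual admissibility of `IsFamily` are used. -/
theorem tight_of_isFamily :
    ∀ (D : DobrushinDomain) (Λ : ℝ → DiscreteDobrushin), IsFamily D Λ → IsTightAlongMesh (iface D Λ) perc := by
  intro D Λ hΛ
  exact isTightAlongMesh_bondInterfaceIn D Λ hΛ.1 hΛ.2.1 hΛ.2.2.2.2.2

/-- **The tightness half of stub S6 `stub_sleLawOnRectilinear`** (registered glue sub-goal):
`TightOnRectilinear`, i.e. tightness of the interface functional along every admissible family of every
rectilinear Dobrushin polygon — the specialisation of `tight_of_isFamily` (the rectilinearity hypothesis is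
idle). -/
theorem tightOnRectilinear : TightOnRectilinear := fun D _ Λ hΛ => tight_of_isFamily D Λ hΛ

end Summit.CriticalPhenomena.CardyFormulaZ2.Cruxes.ParafermionToSLESixFamilies.IicTraceFluxPairing

end
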